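import Summits.BirchSwinnertonDyer.BirchSwinnertonDyer.Theorems.TeichmullerTwistDescentTwistedPeriodLatticeDichotomy
import HarnessLib

/-!
# The minimal `p*`-twist of an optimal curve is optimal, and the Manin constants agree up to `{1, p}`
# (route `TeichmullerTwistDescent`, LINE 11, K stmt-BirchSwinnertonDyer-25368) — modulo modularity

Cell `pub/bsd-wall`, seat `bsd-line-ttd-p1` (g5). THEOREMS ONLY, theses-cone free. A structural
consequence of the index dichotomy (`TwistedPeriodLatticeDichotomy.index_dichotomy_of_modularity`) and of
the integrality of Néron scalings between globally minimal models
(`integral_neronScaling_of_isGloballyMinimal_holds`), GRANTED the Modularity theorem `exists_isNewformOf`: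

* `exists_optimal_twist_datum_of_modularity` — for `W/ℚ` globally minimal, additive and potentially good at
  `p ≥ 5` with `ord_p Δ_min < 6` (Kodaira II/III/IV, the unstarred side), `E[p]` irreducible, and
  `D` a LATTICE-OPTIMAL conductor-level datum of `W` (`W` is the `X₀(N)`-optimal curve, `Λ_W = c·Λ(f)`):
  there is a globally minimal model `V` of the `p*`-twist, `C • W^{(p*)} = V` with `ord_p u(C) = 0`,
  carrying a LATTICE-OPTIMAL datum `D_V` at the same level with newform `f ⊗ χ_p` — i.e. **`V` is the
  `X₀(N)`-optimal curve of the twisted class** — and **`u·c(D) = ±c(D_V)` (saturation, K) or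
  `u·c(D) = ±p·c(D_V)` (Edixhoven's case 1)**.
So, modulo modularity, the crux K at `(W, p, D)` is exactly the statement that the Manin constants of the
optimal curve and of its (optimal) minimal `p*`-twist have the same `p`-adic valuation. In the two cases
the Néron lattices satisfy `Λ_V = r·Λ_{W₀}` with `r = uc/c₀`, resp. `uc/(pc₀)`, rational, and `r, r⁻¹`
integral forces `r = ±1`, `Λ_V = Λ_{W₀}` for the optimal member `W₀` of the twisted class.
BSD is not proved by this; Manin's conjecture is not proved by this; K is not proved by this.
[cite: EdixhovenManin1991, Thm. 3 and §4] [cite: Stevens1989, Lemma (5.2), (5.4) pp. 96–97]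
[cite: SilvermanATAEC1994, IV.5.1 with IV.6.1]
-/

set_option autoImplicit false
-- single-conjunct summit: `Summit.BirchSwinnertonDyer.BirchSwinnertonDyer.…` repeats the name by design
set_option linter.dupNamespace false

noncomputable section

open scoped Classical

open WeierstrassCurve Literature.NumberTheory.EllipticCurves Literature.NumberTheory.EllipticCurves.ModularForms
  Literature.NumberTheory.EllipticCurves.Rank1Residual
  Summit.BirchSwinnertonDyer.Rank1Residual Summit.BirchSwinnertonDyer.Rank1Residual.Additive
  Summit.BirchSwinnertonDyer.BirchSwinnertonDyer.Theorems.TeichmullerTwistDescentStarInvolution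

namespace Summit.BirchSwinnertonDyer.BirchSwinnertonDyer.Theorems.TeichmullerTwistDescent.TwistOptimality

open PeriodLatticeIndexParity TwistFrame TwistedPeriodLatticeDichotomy

/-- **Two Néron lattices of globally minimal models scaled into each other by a rational `r ≠ 0` and its
inverse coincide**: `r, r⁻¹ ∈ ℤ` (`integral_neronScaling_of_isGloballyMinimal_holds`, Néron mapping property)
forces `r = ±1`. [cite: SilvermanATAEC1994, IV.5.1 with IV.6.1] -/
theorem lattice_eq_of_rat_scaling {X Y : WeierstrassCurve ℚ} [X.IsElliptic] [Y.IsElliptic]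
    [X.IsGloballyMinimal] [Y.IsGloballyMinimal] {LX LY : PeriodPair}
    (hLX : IsNeronLatticeOf (X.baseChange ℂ) LX) (hLY : IsNeronLatticeOf (Y.baseChange ℂ) LY) {r : ℚ}
    (hr : r ≠ 0) (h1 : ∀ z ∈ LX.lattice, ((r : ℚ) : ℂ) * z ∈ LY.lattice)
    (h2 : ∀ z ∈ LY.lattice, (((r⁻¹ : ℚ) : ℚ) : ℂ) * z ∈ LX.lattice) :
    (r = 1 ∨ r = -1) ∧ ∀ z : ℂ, z ∈ LX.lattice ↔ z ∈ LY.lattice := by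
  obtain ⟨k, hk⟩ := integral_neronScaling_of_isGloballyMinimal_holds X Y LX LY hLX hLY r h1
  obtain ⟨k', hk'⟩ := integral_neronScaling_of_isGloballyMinimal_holds Y X LY LX hLY hLX r⁻¹ h2
  have hkk : k * k' = 1 := by
    have h : (k : ℚ) * k' = 1 := by rw [hk, hk', mul_inv_cancel₀ hr]
    exact_mod_cast h
  have hr1 : r = 1 ∨ r = -1 := by
    rcases Int.eq_one_or_neg_one_of_mul_eq_one hkk with h | h
    · left; rw [← hk, h]; norm_num
    · right; rw [← hk, h]; norm_num
  refine ⟨hr1, fun z ↦ ⟨fun hz ↦ ?_, fun hz ↦ ?_⟩⟩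
  · have h := h1 z hz
    rcases hr1 with h' | h'
    · rw [h'] at h; simpa using h
    · rw [h'] at h
      have : (((-1 : ℚ) : ℚ) : ℂ) * z = -z := by push_cast; ring
      rw [this] at h
      simpa using neg_mem h
  · have h := h2 z hz
    rcases hr1 with h' | h'
    · rw [h'] at h; simpa using h
    · rw [h'] at h
      have : ((((-1 : ℚ)⁻¹ : ℚ) : ℚ) : ℂ) * z = -z := by push_cast; ring
      rw [this] at h
      simpa using neg_mem h

/-- **The minimal `p*`-twist of the optimal curve is optimal, and the Manin constants agree up to `{1, p}`
(GRANTED modularity).** For `W/ℚ` globally minimal, additive and potentially good at `p ≥ 5`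
(`0 ≤ ord_p j`) with `ord_p Δ_min < 6`, `E[p]` irreducible, and `D` a lattice-optimal conductor-level datum
of `W` (`p² ∣ N`): there is a globally minimal `V`, `C • W^{(p*)} = V` with `ord_p u(C) = 0`, with a
LATTICE-OPTIMAL datum `D_V` at level `N(W)` whose newform is `f_D ⊗ χ_p`, and
`u·c(D) = ±c(D_V)` (the saturated case: K holds at `(W, p, D)`) or `u·c(D) = ±p·c(D_V)` (Edixhoven's
case 1). Proof: twist frame (`V`, optimal `W₀ ∼ V`, `D₀`, `f ⊗ χ = f_{D₀}`); by the index dichotomy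
`Λ_V = r·Λ_{W₀}` with `r = uc/c₀` (index `1`) or `r = uc/(pc₀)` (index `p²`) RATIONAL, and
`lattice_eq_of_rat_scaling` gives `r = ±1`, `Λ_V = Λ_{W₀}`; then `(f_{D₀}, Λ_V, c₀)` is a datum of `V`
(`ModularParametrizationData.exists_of_isNewformOf`), lattice-optimal because `D₀` is.
[cite: EdixhovenManin1991, Thm. 3 and §4] [cite: Stevens1989, Lemma (5.4) p. 97] -/
theorem exists_optimal_twist_datum_of_modularity (hnf : exists_isNewformOf) (W : WeierstrassCurve ℚ)
    [W.IsElliptic] [W.IsGloballyMinimal] (p : ℕ) [Fact p.Prime] [NeZero (W.conductorNorm ℤ)]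
    (D : ModularParametrizationData W (W.conductorNorm ℤ)) (hsq : p ^ 2 ∣ W.conductorNorm ℤ)
    (hp5 : 5 ≤ p) (hadd : Rank1Residual.Addv W p) (hirr : Rank1Residual.Irr W p)
    (hj : 0 ≤ padicValRat p W.j) (hW6 : padicValInt p W.minimalDiscriminantInt < 6)
    (hopt : ∀ z ∈ D.L.lattice, ∃ w ∈ periodLattice D.f, z = D.c * w) :
    ∃ (V : WeierstrassCurve ℚ) (_ : V.IsElliptic) (_ : V.IsGloballyMinimal) (C : VariableChange ℚ)
      (DV : ModularParametrizationData V (W.conductorNorm ℤ)),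
      C • W.quadraticTwist ((-1 : ℚ) ^ (p / 2) * p) = V ∧ padicValRat p (C.u : ℚ) = 0 ∧
      (∀ z ∈ DV.L.lattice, ∃ w ∈ periodLattice DV.f, z = DV.c * w) ∧
      DV.f = charTwist (W.conductorNorm ℤ) (dvd_refl _) hsq (isQuadratic_quadraticChar_ringHomComp p) D.f ∧
      ((C.u : ℚ) * D.c = DV.c ∨ (C.u : ℚ) * D.c = -DV.c ∨
        (C.u : ℚ) * D.c = p * DV.c ∨ (C.u : ℚ) * D.c = -(p * DV.c)) := by
  have hpP : p.Prime := Fact.out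
  have hp2 : p ≠ 2 := by omega
  have hχ := isQuadratic_quadraticChar_ringHomComp p
  have hprim : DirichletCharacter.IsPrimitive ((quadraticChar (ZMod p)).ringHomComp (Int.castRingHom ℂ)) :=
    isPrimitive_quadraticChar_ringHomComp p hp2
  set G : ℂ := gaussSum ((quadraticChar (ZMod p)).ringHomComp (Int.castRingHom ℂ))
    (ZMod.stdAddChar (N := p)) with hGdef
  have hG0 : G ≠ 0 := gaussSum_stdAddChar_ne_zero_of_isPrimitive hprim
  set fχ := charTwist (W.conductorNorm ℤ) (dvd_refl _) hsq hχ D.f with hfχdef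
  have hStevens : ∀ w ∈ periodLattice fχ, G * w ∈ periodLattice D.f := fun w hw ↦
    gaussSum_mul_mem_periodLattice_of_mem_charTwist (W.conductorNorm ℤ) (dvd_refl _) hsq hχ hprim D.f hw
  have hFrame : ∀ z ∈ periodLattice D.f, ∃ w ∈ periodLattice fχ, (p : ℂ) * z = G * w := fun z hz ↦
    TwistedPeriodLatticeIndexFrame.natCast_mul_mem_gaussSum_mul_periodLattice_charTwist_of_modularParametrizationData
      W p D hsq _ hχ hprim hz
  -- the twist frame and the dichotomy
  obtain ⟨V, W₀, hVe, hVm, hE₀, hM₀, C, LV, D₀, hC, hu, hLV, hiso, -, hopt₀, hfeq⟩ :=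
    exists_twist_frame hnf W p D hsq hp5 hadd hirr hj hW6 hχ
  haveI := hVe
  haveI := hVm
  haveI := hE₀
  haveI := hM₀
  have htw : ∀ x : ℂ, x ∈ LV.lattice ↔ G * ((((C.u : ℚ) : ℂ))⁻¹ * x) ∈ D.L.lattice := fun x ↦
    mem_lattice_twist_pStar_iff p hp2 W V D.isNeronLattice hLV C hC x
  have hc : D.c ≠ 0 := D.maninConstant_ne_zero_holds
  have hc₀ : D₀.c ≠ 0 := D₀.maninConstant_ne_zero_holds
  have hu0 : (C.u : ℚ) ≠ 0 := C.u.ne_zero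
  have hcℂ : (D.c : ℂ) ≠ 0 := by exact_mod_cast hc
  have hc₀ℂ : (D₀.c : ℂ) ≠ 0 := by exact_mod_cast hc₀
  have huℂ : (((C.u : ℚ) : ℚ) : ℂ) ≠ 0 := by exact_mod_cast hu0
  have hpℂ : (p : ℂ) ≠ 0 := by exact_mod_cast hpP.ne_zero
  have hfV : IsNewformOf V D₀.f := D₀.isNewformOf.of_isIsogenous hiso
  -- common conclusion from `Λ_V = Λ_{W₀}`
  have conclude : (∀ z : ℂ, z ∈ D₀.L.lattice ↔ z ∈ LV.lattice) →
      ((C.u : ℚ) * D.c = D₀.c ∨ (C.u : ℚ) * D.c = -D₀.c ∨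
        (C.u : ℚ) * D.c = p * D₀.c ∨ (C.u : ℚ) * D.c = -(p * D₀.c)) →
      ∃ (V : WeierstrassCurve ℚ) (_ : V.IsElliptic) (_ : V.IsGloballyMinimal) (C : VariableChange ℚ)
        (DV : ModularParametrizationData V (W.conductorNorm ℤ)),
        C • W.quadraticTwist ((-1 : ℚ) ^ (p / 2) * p) = V ∧ padicValRat p (C.u : ℚ) = 0 ∧
        (∀ z ∈ DV.L.lattice, ∃ w ∈ periodLattice DV.f, z = DV.c * w) ∧
        DV.f = fχ ∧
        ((C.u : ℚ) * D.c = DV.c ∨ (C.u : ℚ) * D.c = -DV.c ∨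
          (C.u : ℚ) * D.c = p * DV.c ∨ (C.u : ℚ) * D.c = -(p * DV.c)) := by
    intro hLeq hrel
    have hle : ∀ z ∈ periodLattice D₀.f, (D₀.c : ℂ) * z ∈ LV.lattice := fun z hz ↦
      (hLeq _).mp (D₀.smul_periodLattice_le z hz)
    obtain ⟨DV, hDVf, hDVL, hDVc⟩ := ModularParametrizationData.exists_of_isNewformOf hfV hLV hc₀ hle
    refine ⟨V, hVe, hVm, C, DV, hC, hu, ?_, by rw [hDVf]; exact hfeq.symm, by rw [hDVc]; exact hrel⟩
    intro z hz
    rw [hDVL] at hz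
    obtain ⟨w, hw, hzw⟩ := hopt₀ z ((hLeq z).mpr hz)
    exact ⟨w, by rw [hDVf]; exact hw, by rw [hDVc]; exact hzw⟩
  rcases index_dichotomy_of_modularity hnf W p D hsq hp5 hadd hirr hj hW6 hopt _ hχ hprim with hsat | hcase
  · -- saturated case: `Λ_V = (uc/c₀) Λ_{W₀}`
    set r : ℚ := (C.u : ℚ) * (D.c : ℚ) / (D₀.c : ℚ) with hrdef
    have hr0 : r ≠ 0 := by
      rw [hrdef]; exact div_ne_zero (mul_ne_zero hu0 (by exact_mod_cast hc)) (by exact_mod_cast hc₀)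
    have hrℂ : ((r : ℚ) : ℂ) = (((C.u : ℚ) : ℚ) : ℂ) * (D.c : ℂ) / (D₀.c : ℂ) := by
      rw [hrdef]; push_cast; ring
    have hr1 : ∀ z ∈ D₀.L.lattice, ((r : ℚ) : ℂ) * z ∈ LV.lattice := by
      intro x hx
      obtain ⟨w', hw', rfl⟩ := hopt₀ x hx
      rw [← hfeq] at hw'
      have h1 : (D.c : ℂ) * (G * w') ∈ D.L.lattice := D.smul_periodLattice_le _ (hStevens w' hw')
      have e : G * ((((C.u : ℚ) : ℚ) : ℂ)⁻¹ * (((r : ℚ) : ℂ) * ((D₀.c : ℂ) * w'))) = (D.c : ℂ) * (G * w') := by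
        rw [hrℂ]
        field_simp
      rw [htw, e]
      exact h1
    have hr2 : ∀ z ∈ LV.lattice, (((r⁻¹ : ℚ) : ℚ) : ℂ) * z ∈ D₀.L.lattice := by
      intro y hy
      have h1 := (htw y).mp hy
      obtain ⟨z, hz, hz'⟩ := hopt _ h1
      obtain ⟨w, hw, rfl⟩ := hsat z hz
      have h2 : (D₀.c : ℂ) * w ∈ D₀.L.lattice := D₀.smul_periodLattice_le _ (hfeq ▸ hw)
      have hy' : y = (((C.u : ℚ) : ℚ) : ℂ) * ((D.c : ℂ) * (G * w)) / G := by
        rw [← hz']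
        field_simp
      have e : (((r⁻¹ : ℚ) : ℚ) : ℂ) * y = (D₀.c : ℂ) * w := by
        rw [hy', Rat.cast_inv, hrℂ]
        field_simp
      rw [e]
      exact h2
    obtain ⟨hr, hLeq⟩ := lattice_eq_of_rat_scaling D₀.isNeronLattice hLV hr0 hr1 hr2
    refine conclude hLeq ?_
    have e : (C.u : ℚ) * D.c = r * D₀.c := by rw [hrdef]; field_simp
    rcases hr with h | h
    · exact Or.inl (by rw [e, h, one_mul])
    · exact Or.inr (Or.inl (by rw [e, h, neg_one_mul]))
  · -- Edixhoven's case 1: `Λ_V = (uc/(pc₀)) Λ_{W₀}`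
    set r : ℚ := (C.u : ℚ) * (D.c : ℚ) / ((p : ℚ) * (D₀.c : ℚ)) with hrdef
    have hr0 : r ≠ 0 := by
      rw [hrdef]
      exact div_ne_zero (mul_ne_zero hu0 (by exact_mod_cast hc))
        (mul_ne_zero (by exact_mod_cast hpP.ne_zero) (by exact_mod_cast hc₀))
    have hrℂ : ((r : ℚ) : ℂ) = (((C.u : ℚ) : ℚ) : ℂ) * (D.c : ℂ) / ((p : ℂ) * (D₀.c : ℂ)) := by
      rw [hrdef]; push_cast; ring
    have hr1 : ∀ z ∈ D₀.L.lattice, ((r : ℚ) : ℂ) * z ∈ LV.lattice := by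
      intro x hx
      obtain ⟨w', hw', rfl⟩ := hopt₀ x hx
      rw [← hfeq] at hw'
      obtain ⟨z, hz, hzw⟩ := hcase w' hw'
      have h1 : (D.c : ℂ) * z ∈ D.L.lattice := D.smul_periodLattice_le _ hz
      have e : G * ((((C.u : ℚ) : ℚ) : ℂ)⁻¹ * (((r : ℚ) : ℂ) * ((D₀.c : ℂ) * w'))) = (D.c : ℂ) * z := by
        rw [hrℂ]
        field_simp
        linear_combination hzw
      rw [htw, e]
      exact h1
    have hr2 : ∀ z ∈ LV.lattice, (((r⁻¹ : ℚ) : ℚ) : ℂ) * z ∈ D₀.L.lattice := by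
      intro y hy
      have h1 := (htw y).mp hy
      obtain ⟨z, hz, hz'⟩ := hopt _ h1
      obtain ⟨w', hw', hw''⟩ := hFrame z hz
      have h2 : (D₀.c : ℂ) * w' ∈ D₀.L.lattice := D₀.smul_periodLattice_le _ (hfeq ▸ hw')
      have hy' : y = (((C.u : ℚ) : ℚ) : ℂ) * ((D.c : ℂ) * z) / G := by
        rw [← hz']
        field_simp
      have e : (((r⁻¹ : ℚ) : ℚ) : ℂ) * y = (D₀.c : ℂ) * w' := by
        rw [hy', Rat.cast_inv, hrℂ]
        field_simp
        linear_combination hw''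
      rw [e]
      exact h2
    obtain ⟨hr, hLeq⟩ := lattice_eq_of_rat_scaling D₀.isNeronLattice hLV hr0 hr1 hr2
    refine conclude hLeq ?_
    have e : (C.u : ℚ) * D.c = r * (p * D₀.c) := by rw [hrdef]; field_simp
    rcases hr with h | h
    · exact Or.inr (Or.inr (Or.inl (by rw [e, h, one_mul])))
    · exact Or.inr (Or.inr (Or.inr (by rw [e, h, neg_one_mul])))

end Summit.BirchSwinnertonDyer.BirchSwinnertonDyer.Theorems.TeichmullerTwistDescent.TwistOptimality

end
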